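import Summits.HodgeConjecture.CorCM.Census.BlockParityBurnside

/-!
# The block-parity law, VII: the number of blocks of a CYCLIC Galois CM type — `β(ℤ/2m)·2m = Σ_{d | 2m, d odd} φ(d)·2^{m/d}`

COR-CM (cell `pub-hodgecm2`), count-neutral kernel combinatorics by the binder seat b09 (gen 28; lane BLOCK-PARITY-FLOOR),
part VII, sequel of `Census/BlockParityBurnside.lean` (VI: `card_block_mul_card`, Burnside for base change).  Theorems only;
no certificate, no named fact, no `sorry`.  HONEST FRAMING: `HC_CM` is NOT proved; nothing here is a period or a headline.

CONTENT.  For a finite CYCLIC group `G` (so every involution is central and unique) with an involution `c ≠ 1`: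
* `mem_zpowers_iff_even_orderOf`: `c ∈ ⟨g⟩ ⟺ orderOf g` is even (the unique involution of a cyclic group);
* **`card_block_mul_card_of_isCyclic`**: `β(G,c) · |G| = Σ_{d ∣ |G|, d odd} φ(d) · 2^{|G|/2/d}` — regrouping VI's Burnside sum by
  element orders (`IsCyclic.card_orderOf_eq_totient`).  For `G = ℤ/2m` this is the necklace-type count
  `β·2m = Σ_{d | m, d odd} φ(d) 2^{m/d}`: `β = 2, 2, 4, 6, 10, 16, 30, 52, 94, 172, 316, …` for `2m = 6, 8, …, 26`, i.e. with part V
  (`δ = 0` for cyclic `G`) the block-parity law gives **`μ(ℤ/2m) ≥ β − 1 = 1, 1, 3, 5, 9, 15, 29, 51, 93, 171, 315`** — André-3's exact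
  minima on every cyclic row `ℤ/6 … ℤ/22` of the atlas, b17's `(2^{p−1} − 1)/p` at `2m = 2p`, and b09 gen 24's `μ(ℤ/22) = 93`
  (numerals not decided here; they follow from this formula by arithmetic).  DICTIONARY: cyclic Galois CM fields include `ℚ(ζ_{p^k})`
  (`p` odd) and their CM subfields [cite: Milne1999, Prop. 2.1, p. 54] (blocks ↔ simple CM isogeny classes split by `F`).

## References
* [Pohlmann1968] H. Pohlmann, Algebraic cycles on abelian varieties of complex multiplication type, Ann. of Math. 88 (1968), Thm 1.
* [Milne1999] J. S. Milne, Lefschetz motives and the Tate conjecture, Compositio Math. 117 (1999), Prop. 2.1, p. 54.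
-/

namespace Summit.HodgeConjecture.CorCM.Census.BlockParity

open Finset
open Summit.HodgeConjecture.CorCM.Prior.AllgGroup.RfwfAllgGroup

noncomputable section

variable {G : Type*} [Group G] [Fintype G] [DecidableEq G] (c : G)

omit [DecidableEq G] in
/-- **In a cyclic group an involution `c` lies in `⟨g⟩` iff `orderOf g` is even** (the involution of a cyclic group is unique).
[folklore] -/
theorem mem_zpowers_iff_even_orderOf [IsCyclic G] (hc2 : c * c = 1) (hc1 : c ≠ 1) (g : G) :
    c ∈ Subgroup.zpowers g ↔ Even (orderOf g) := by
  classical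
  have hoc : orderOf c = 2 := orderOf_eq_prime (by rw [pow_two]; exact hc2) hc1
  constructor
  · intro h
    have hd := orderOf_dvd_of_mem_zpowers h
    rw [hoc] at hd
    exact even_iff_two_dvd.mpr hd
  · intro he
    obtain ⟨k, hk⟩ := he
    have hk2 : orderOf g = 2 * k := by omega
    have hkpos : 0 < k := by
      have := orderOf_pos g; omega
    have hx : orderOf (g ^ k) = 2 := by
      rw [orderOf_pow' g hkpos.ne', hk2, Nat.gcd_mul_left_left, Nat.mul_div_cancel 2 hkpos]
    -- the involution of a cyclic group is unique
    have h2 : 2 ∣ Fintype.card G := by rw [← hoc]; exact orderOf_dvd_card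
    have hcard := IsCyclic.card_orderOf_eq_totient (α := G) h2
    rw [Nat.totient_two, Finset.card_eq_one] at hcard
    obtain ⟨a, ha⟩ := hcard
    have hca : c = a := by
      have : c ∈ ({a} : Finset G) := by rw [← ha]; simp [hoc]
      simpa using this
    have hxa : g ^ k = a := by
      have : g ^ k ∈ ({a} : Finset G) := by rw [← ha]; simp [hx]
      simpa using this
    rw [hca, ← hxa]
    exact Subgroup.pow_mem _ (Subgroup.mem_zpowers g) k

omit [Fintype G] [DecidableEq G] in
/-- In a cyclic group every element commutes with `c`. [folklore] -/
theorem mul_comm_of_isCyclic [IsCyclic G] (x : G) : x * c = c * x := by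
  obtain ⟨g, hg⟩ := IsCyclic.exists_generator (α := G)
  obtain ⟨i, hi⟩ := Subgroup.mem_zpowers_iff.mp (hg x)
  obtain ⟨j, hj⟩ := Subgroup.mem_zpowers_iff.mp (hg c)
  rw [← hi, ← hj]
  exact (Commute.zpow_zpow (Commute.refl g) i j).eq

/-- **THE NUMBER OF BLOCKS OF A CYCLIC GALOIS CM TYPE**: `β(G,c) · |G| = Σ_{d ∣ |G|, d odd} φ(d) · 2^{|G|/2/d}`; for `G = ℤ/2m`:
`β · 2m = Σ_{d | m, d odd} φ(d) 2^{m/d}`. [folklore] -/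
theorem card_block_mul_card_of_isCyclic [IsCyclic G] (hc2 : c * c = 1) (hc1 : c ≠ 1) :
    Fintype.card (Block c) * Fintype.card G =
      ∑ d ∈ (Fintype.card G).divisors with Odd d, Nat.totient d * 2 ^ (Fintype.card G / 2 / d) := by
  classical
  rw [card_block_mul_card c hc2 (mul_comm_of_isCyclic c)]
  have hterm : ∀ g : G, (if c ∈ Subgroup.zpowers g then 0 else 2 ^ (Fintype.card G / orderOf g / 2)) =
      (fun d => if Even d then 0 else 2 ^ (Fintype.card G / 2 / d)) (orderOf g) := by
    intro g
    simp only [mem_zpowers_iff_even_orderOf c hc2 hc1 g]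
    split_ifs
    · rfl
    · rw [Nat.div_div_eq_div_mul, Nat.div_div_eq_div_mul, mul_comm]
  rw [Finset.sum_congr rfl (fun g _ => hterm g),
    ← Finset.sum_fiberwise_of_maps_to' (s := (Finset.univ : Finset G)) (t := (Fintype.card G).divisors)
      (g := fun g : G => orderOf g) (fun g _ => Nat.mem_divisors.mpr ⟨orderOf_dvd_card, Fintype.card_ne_zero⟩)
      (fun d => if Even d then 0 else 2 ^ (Fintype.card G / 2 / d)),
    Finset.sum_filter]
  refine Finset.sum_congr rfl fun d hd => ?_
  rw [Finset.sum_const, smul_eq_mul, IsCyclic.card_orderOf_eq_totient (Nat.mem_divisors.mp hd).1]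
  by_cases hodd : Odd d
  · rw [if_pos hodd, if_neg (Nat.not_even_iff_odd.mpr hodd)]
  · rw [if_neg hodd, if_pos (Nat.not_odd_iff_even.mp hodd), mul_zero]

end

end Summit.HodgeConjecture.CorCM.Census.BlockParity
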